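import Summits.ABC.StewartYu.PadicG3TwoValues
import Summits.ABC.StewartYu.GenThreeEndBridgeTwo
import HarnessLib

/-!
# Cell abc-stewartyu, Gen-3 frame at `p = 2` (crux `Y07Two`, stmt-ABC-19659), layer F7a: the END ADAPTER —
# from the frame's native identities `g3φ τ x = 0` on `TwoSetup` to `FrameOutputTwo` of the zero estimate

`Summits/ABC/StewartYu/PadicG3TwoEndAdapter.lean` — cell `abc-stewartyu` (HOME `run/shared/lean/pub/abc-stewartyu/`),
route `PadicPrimesKummerThird`, seat p3 (g5), F-two LEAD (layer plan HOME/p3/memo-09 §3/§7, F7).  Theorems on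
`TwoSetup`.

The frame's last level delivers `g3φ τ x = 0` (`PadicG3TwoFunctions.g3φ`: Hasse `Y₀`-weights, the `zγ`-form of
the directional monomials, the monomial `zmon` in the `d` free generators and `θ`) for all integer points
`|x| ≤ (d+2)·X` and all multi-indices `|τ| ≤ (d+2)·S₀`.  `GenThreeEndBridgeTwo.frameOutputTwo_of_hasseIdentities`
wants the same identities indexed over ALL `d + 1` generators `all = (α, θ)` with the pivot `j₀ = θ` (the last
index), the exponent vectors `κᵢ = (uᵢ, u_θᵢ)`, the coefficient vector `ball = (b, b_θ)` and the INTEGER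
directional scalars `b_θ·κᵢₖ − bₖ·κᵢθ = 𝔛ₖ(i)`.  `frameOutputTwo_of_g3φ` is that re-indexing:
multiply the native identity by `b_θ^{|t|}` (`PadicG3TwoValues.bθ_pow_mul_zγpow`), split the products over
`Fin (d+1)` at the last index (`ν θ = 0` kills the pivot factor), and read `zmon` as `∏ allⱼ^{x·κᵢⱼ}`.

WHAT THIS IS NOT: no frame, no record; no crux moves.

References: Yu. V. Nesterenko, LNM 1819 (2003), §5.1 (5.1)–(5.4); K. Yu, Acta Math. 211 (2013), (5.4), §6.
-/

noncomputable section

open Finset Polynomial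
open Literature.NumberTheory.Transcendental
open Literature.NumberTheory.Transcendental.CW77.Setup (Tau tauNorm)

namespace Summit.ABC.StewartYu

namespace TwoSetup

variable (S : TwoSetup) {ι : Type*} (R : ι → ℚ[X]) (u : ι → Fin S.d → ℤ) (uθ : ι → ℤ)

/-- The exponent vector of the unknown `i` over all `d + 1` generators: `κᵢ = (uᵢ, u_θᵢ)`. [folklore] -/
abbrev allκ (i : ι) : Fin (S.d + 1) → ℤ := Fin.snoc (u i) (uθ i)

/-- `∏ⱼ allⱼ^{x·κᵢⱼ} = zmon(uᵢ, u_θᵢ, x)`. [folklore] -/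
theorem prod_all_zpow_eq_zmon (i : ι) (x : ℤ) :
    ∏ j : Fin (S.d + 1), S.toQ.all j ^ (x * S.allκ u uθ i j) = S.zmon (u i) (uθ i) x := by
  rw [S.zmon_eq_prod_all]
  refine Finset.prod_congr rfl fun j _ => ?_
  unfold allκ allExp
  refine Fin.lastCases ?_ (fun k => ?_) j
  · simp only [Fin.snoc_last]; rw [mul_comm]
  · simp only [Fin.snoc_castSucc]; rw [mul_comm]

/-- The directional scalars of the bridge at the pivot `θ`: for `k < d` they are `𝔛ₖ(i)`, at `k = θ` the
factor is killed by `ν θ = 0`. [folklore] -/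
theorem prod_bridgeScalar_pow_eq (i : ι) (ν : Fin (S.d + 1) → ℕ) (hν : ν (Fin.last S.d) = 0) :
    ∏ k : Fin (S.d + 1), (((S.ball (Fin.last S.d) * S.allκ u uθ i k -
        S.ball k * S.allκ u uθ i (Fin.last S.d) : ℤ) : ℚ)) ^ ν k =
      ∏ j : Fin S.d, (S.dirScalar (u i) (uθ i) j : ℚ) ^ ν (Fin.castSucc j) := by
  rw [Fin.prod_univ_castSucc, hν, pow_zero, mul_one]
  refine Finset.prod_congr rfl fun j _ => ?_
  unfold ball allκ dirScalar
  simp only [Fin.snoc_last, Fin.snoc_castSucc]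

/-- **THE END ADAPTER.**  Native identities of the `2`-adic frame on `TwoSetup` ⇒ `FrameOutputTwo` for the
`d + 1` generators `all = (α, θ)`, pivot `θ`, exponent box `(Dbox, D_θ)`:
if `g3φ τ x = 0` for all `|x| ≤ (d+2)X`, `|τ| ≤ (d+2)S₀`, the `Y₀`-factors have degree `≤ D₀`, and one
`κ`-fibre `∑_{κᵢ = κ₀} pᵢ Rᵢ ≠ 0`, then
`FrameOutputTwo (d+1) all ball θ D₀ S₀ X (Dbox, D_θ)`. [cite: Nesterenko2003, §5.1 (5.1)–(5.4)] -/
theorem frameOutputTwo_of_g3φ (B : Finset ι) (p : ι → ℤ) {D₀ S₀ X : ℕ} {Dbox : Fin S.d → ℕ} {Dθ : ℕ}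
    (hR : ∀ i ∈ B, (R i).natDegree ≤ D₀)
    (hu : ∀ i ∈ B, ∀ j, |u i j| ≤ (Dbox j : ℤ)) (huθ : ∀ i ∈ B, |uθ i| ≤ (Dθ : ℤ))
    (hne : ∃ κ₀ : Fin (S.d + 1) → ℤ,
      ∑ i ∈ B.filter (fun i => S.allκ u uθ i = κ₀), (p i : ℚ) • R i ≠ 0)
    (hzero : ∀ x : ℤ, |x| ≤ (((S.d + 1 + 1) * X : ℕ) : ℤ) → ∀ τ : Tau S.d,
      tauNorm τ ≤ (S.d + 1 + 1) * S₀ → S.g3φ R u uθ B p τ x = 0) :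
    GenThreeFrameSpecTwo.FrameOutputTwo (S.d + 1) S.toQ.all S.ball (Fin.last S.d) D₀ S₀ X
      (Fin.snoc Dbox Dθ) := by
  classical
  refine GenThreeEndBridgeTwo.frameOutputTwo_of_hasseIdentities B R (S.allκ u uθ) (fun i => (p i : ℚ))
    S.toQ.all S.ball (Fin.last S.d) D₀ S₀ X (Fin.snoc Dbox Dθ) hR ?_ hne ?_
  · -- the exponent box over all generators
    intro i hi j
    unfold allκ
    refine Fin.lastCases ?_ (fun k => ?_) j
    · simp only [Fin.snoc_last]; exact huθ i hi
    · simp only [Fin.snoc_castSucc]; exact hu i hi k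
  · -- the identities
    intro x hx t ν hν hT
    set ν' : Fin S.d → ℕ := fun j => ν (Fin.castSucc j) with hν'
    have hτ : tauNorm ((t, ν') : Tau S.d) ≤ (S.d + 1 + 1) * S₀ := by
      unfold tauNorm
      have : ∑ k : Fin (S.d + 1), ν k = ∑ j : Fin S.d, ν' j := by
        rw [Fin.sum_univ_castSucc, hν, add_zero]
      simp only
      omega
    have h0 := hzero x hx (t, ν') hτ
    -- multiply the native identity by `b_θ^{|ν'|}`
    have h1 : (S.bθ : ℚ) ^ (∑ j, ν' j) * S.g3φ R u uθ B p (t, ν') x = 0 := by rw [h0, mul_zero]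
    unfold g3φ at h1
    rw [Finset.mul_sum] at h1
    rw [← h1]
    refine Finset.sum_congr rfl fun i _ => ?_
    rw [S.prod_bridgeScalar_pow_eq u uθ i ν hν, S.prod_all_zpow_eq_zmon u uθ i x,
      ← S.bθ_pow_mul_zγpow u uθ i ν']
    simp only
    ring

end TwoSetup

end Summit.ABC.StewartYu

end
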